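import Summits.RiemannHypothesis.RiemannHypothesis.Theses.WeilGroundState
import Literature.Analysis.Complex.Hurwitz

/-!
# RiemannHypothesis / WeilGroundState — the assembly `Assembly`

Route `RiemannHypothesis/WeilGroundState` (Perron–Frobenius for the Weil ground state), item
stmt-RiemannHypothesis-1532 (`Assembly`, rank 1):

  `GroundStateSimpleEven → GroundStateMellinRealZeros → GroundStatesConvergeToXi → Summit.RiemannHypothesis`.

This is the bookkeeping step of Connes' strategy (Connes–van Suijlekom, CMP 2025, Thm 1.2/6.1;
Connes–Consani–Moscovici 2025 §7: "this convergence would entail RH using Hurwitz theorem"), with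
the three cruxes taken as hypotheses:

* `GroundStatesConvergeToXi` provides windows `a_k → ∞`, ground states `u_k` and constants
  `c_k ≠ 0` with `F_k := c_k · weilMellin u_k → ξ` locally uniformly on the open critical strip;
* `GroundStateSimpleEven` at the window `a_k` is, verbatim, the hypothesis of
  `GroundStateMellinRealZeros` at `a_k`, so every `F_k` is entire with all its zeros on
  `Re s = 1/2`; in particular `F_k` is zero-free on the right half `U := {1/2 < Re s < 1}` of the
  open strip (open; convex, hence preconnected);
* Hurwitz's theorem in the tree (`Complex.hurwitz_eqOn_zero_or_forall_ne_zero`,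
  `Literature/Analysis/Complex/Hurwitz.lean`, filter `atTop` on `ℕ`) gives: `ξ ≡ 0` on `U` — which
  the identity theorem excludes (`ξ` is entire and `ξ(0) = 1/2`) — or `ξ` is zero-free on `U`;
* by the functional equation `ξ(1 - s) = ξ(s)` the zero-free region reflects to
  `{0 < Re s < 1/2}`, so every zero of `ξ` in the open strip has `Re s = 1/2`; since the zeros of
  `ξ` are exactly the zeros of `ζ` in the open strip (`riemannXi_eq_zero_iff_holds`) and every
  nontrivial zero of `ζ` in Mathlib's sense is a zero of `ξ` (`riemannXi_eq_zero_of_nontrivial`),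
  Mathlib's `RiemannHypothesis` — definitionally the summit statement `Summit.RiemannHypothesis`
  (`Summit.RiemannHypothesis_iff`) — follows.

The proof is self-contained (it uses only the route's item definitions and Literature/Mathlib
lemmas) and agrees step for step with the route file's kernel-checked deciding theorem
`Summit.RiemannHypothesis.RiemannHypothesis.Theses.WeilGroundState.closes` (rev 3). Nothing here is
new mathematics and no auxiliary declaration is introduced.

References: A. Connes, W. D. van Suijlekom, *Quadratic forms, real zeros and echoes of the spectral
action*, Comm. Math. Phys. (2025), Thm 1.2/6.1 [ConnesSuijlekom2025]; A. Connes, C. Consani,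
H. Moscovici, arXiv:2511.22755, §7 [ConnesConsaniMoscovici2025]; J. B. Conway, *Functions of one
complex variable*, VII.2.5 (Hurwitz) [Conway1978]; E. C. Titchmarsh, *The theory of the Riemann
zeta-function*, §2.1, §2.12 [Titchmarsh1986].
-/

-- D-0017: single-problem summit ⇒ namespace `Summit.RiemannHypothesis.RiemannHypothesis.…` by design
-- (the Summits library sets `weak.linter.dupNamespace = false`; repeated here for standalone checks).
set_option linter.dupNamespace false

namespace Summit.RiemannHypothesis.RiemannHypothesis.Theorems

open Summit.RiemannHypothesis.RiemannHypothesis.Theses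
open Literature.NumberTheory.LFunctions

/-- **Assembly of route WeilGroundState** (item stmt-RiemannHypothesis-1532):
`GroundStateSimpleEven → GroundStateMellinRealZeros → GroundStatesConvergeToXi → Summit.RiemannHypothesis`.
Take `(a_k, u_k, c_k)` from `GroundStatesConvergeToXi`; `GroundStateSimpleEven` at `a_k` discharges
the hypothesis of `GroundStateMellinRealZeros`, so `F_k := c_k · weilMellin u_k` is entire with all
zeros on `Re s = 1/2`, hence zero-free on `U := {1/2 < Re s < 1}`; `F_k → ξ` locally uniformly on
`U`; Hurwitz (`Complex.hurwitz_eqOn_zero_or_forall_ne_zero`) ⇒ `ξ ≡ 0` on `U` (excluded by the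
identity theorem and `ξ(0) = 1/2`) or `ξ` is zero-free on `U`; with `ξ(1 - s) = ξ(s)`,
`riemannXi_eq_zero_iff_holds` and `riemannXi_eq_zero_of_nontrivial`, every nontrivial zero of `ζ`
has `Re s = 1/2`. [cite: ConnesSuijlekom2025, Thm 1.2/6.1; Conway1978, VII.2.5] -/
theorem weilGroundStateAssembly_proof : WeilGroundState.Assembly := by
  unfold WeilGroundState.Assembly
  intro h₁ h₂ h₃
  classical
  obtain ⟨a, u, c, -, hk, hlim⟩ := h₃
  -- the approximants `F_k := c_k · weilMellin u_k` are entire with all zeros on `Re s = 1/2`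
  have hF : ∀ k, Differentiable ℂ (fun s => c k * weilMellin (u k) s) ∧
      ∀ s, c k * weilMellin (u k) s = 0 → s.re = 1 / 2 := by
    intro k
    obtain ⟨hak, hck, hu, g, hg, hQ, hL2⟩ := hk k
    obtain ⟨hdiff, hzero⟩ := h₂ (a k) hak (h₁ (a k) hak) (u k) hu ⟨g, hg, hQ, hL2⟩
    refine ⟨(differentiable_const (c k)).mul hdiff, fun s hs => hzero s ?_⟩
    rcases mul_eq_zero.1 hs with h | h
    · exact absurd h hck
    · exact h
  -- the right half `U` of the open critical strip: open and convex (hence preconnected)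
  set U : Set ℂ := {s : ℂ | 1 / 2 < s.re ∧ s.re < 1} with hUdef
  have hUo : IsOpen U :=
    (isOpen_lt continuous_const Complex.continuous_re).inter
      (isOpen_lt Complex.continuous_re continuous_const)
  have hUc : Convex ℝ U := (convex_halfSpace_re_gt (1 / 2)).inter (convex_halfSpace_re_lt 1)
  -- locally uniform convergence restricts from the strip to `U`
  have hlimU : TendstoLocallyUniformlyOn (fun k s => c k * weilMellin (u k) s) riemannXi
      Filter.atTop U :=
    hlim.mono fun s hs => ⟨by linarith [hs.1], hs.2⟩
  have hFd : ∀ᶠ k in Filter.atTop, DifferentiableOn ℂ (fun s => c k * weilMellin (u k) s) U :=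
    Filter.Eventually.of_forall fun k => (hF k).1.differentiableOn
  have hFne : ∃ᶠ k in Filter.atTop, ∀ z ∈ U, c k * weilMellin (u k) z ≠ 0 :=
    Filter.Frequently.of_forall fun k z hz hz0 => by
      have := (hF k).2 z hz0
      linarith [hz.1]
  -- Hurwitz: the limit `ξ` vanishes identically on `U` or is zero-free there
  rcases Complex.hurwitz_eqOn_zero_or_forall_ne_zero hUo hUc.isPreconnected hFd hlimU hFne with
    hzero | hne
  · -- `ξ ≡ 0` on `U` is impossible: `ξ` is entire and `ξ(0) = 1/2`
    exfalso
    have han : AnalyticOnNhd ℂ riemannXi Set.univ :=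
      differentiable_riemannXi.differentiableOn.analyticOnNhd isOpen_univ
    have hz₀ : ((3 : ℂ) / 4) ∈ U := by
      refine ⟨?_, ?_⟩ <;> norm_num
    have hev : riemannXi =ᶠ[nhds ((3 : ℂ) / 4)] 0 :=
      Filter.eventuallyEq_of_mem (hUo.mem_nhds hz₀) hzero
    have hall := han.eqOn_zero_of_preconnected_of_eventuallyEq_zero isPreconnected_univ
      (Set.mem_univ _) hev
    have h0 := hall (Set.mem_univ (0 : ℂ))
    rw [riemannXi_zero] at h0
    norm_num at h0
  · -- `ξ` is zero-free on `U`, hence (functional equation) on the open strip off the line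
    show _root_.RiemannHypothesis
    intro s hzeta htriv hone
    have hxi := riemannXi_eq_zero_of_nontrivial hzeta htriv hone
    obtain ⟨-, h0, h1⟩ := (riemannXi_eq_zero_iff_holds s).1 hxi
    by_contra hne'
    rcases lt_or_gt_of_ne hne' with hlt | hgt
    · refine hne (1 - s) ⟨?_, ?_⟩ ((riemannXi_one_sub s).trans hxi)
      · simp only [Complex.sub_re, Complex.one_re]; linarith
      · simp only [Complex.sub_re, Complex.one_re]; linarith
    · exact hne s ⟨hgt, h1⟩ hxi

end Summit.RiemannHypothesis.RiemannHypothesis.Theorems
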